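import Mathlib
import Literature.Analysis.ODE.InverseSquareTailRecessive
import Literature.Analysis.ODE.PowerScaleAsymptotics

/-!
# A fundamental system `u ~ x^{-ℓ}`, `u₂ ~ x^{ℓ+1}/(2ℓ+1)` of `u'' = (ℓ(ℓ+1)/x² + W) u` at `+∞`

Analysis/ODE support file (everything proved, no definitions), continuing
`InverseSquareTailRecessive.lean`. From the recessive solution `u > 0` the dominant solution is
obtained by reduction of order, `u₂ = u ∫_X^x u^{-2}`, normalised by the Wronskian `u u₂' − u' u₂ = 1`.
In the power scale of `PowerScaleAsymptotics.lean` (`x^p = Real.rpow x p`, errors `O(x^{p−1/2})`):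

  `u = x^{-ℓ} + O(x^{-ℓ-1/2})`,        `u' = −ℓ x^{-ℓ-1} + O(x^{-ℓ-3/2})`,
  `u₂ = x^{ℓ+1}/(2ℓ+1) + O(x^{ℓ+1/2})`,  `u₂' = (ℓ+1)x^ℓ/(2ℓ+1) + O(x^{ℓ-1/2})`

(`exists_fundamental_inverseSquareTail`, one common constant). Hypotheses as before: `X ≥ 1`, `W`
continuous on `[X, ∞)`, `|W| ≤ A/(x²√x)`, `12A ≤ √X`. Folklore (Hartman, *Ordinary Differential
Equations*, Ch. XI §9); used for the far-side `t`-polynomial kernel of the Regge–Wheeler channel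
estimate (route PhotonSphereChannels, `FixedModeChannels`, stmt-FinalStateConjecture-10048).
-/

noncomputable section

namespace Literature.Analysis.ODE

open MeasureTheory Set Filter Topology Real

variable {W : ℝ → ℝ} {X A : ℝ}

/-- `x^{-n} = (xⁿ)⁻¹` for `x ≥ 0` (real vs natural exponent). [folklore] -/
private theorem rpow_neg_natCast_inv {x : ℝ} (hx : 0 ≤ x) (n : ℕ) : x ^ (-(n : ℝ)) = (x ^ n)⁻¹ := by
  rw [Real.rpow_neg hx, Real.rpow_natCast]

/-- `x^{p − 1/2} = x^p/√x` for `x > 0`. [folklore] -/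
private theorem rpow_sub_half_eq {x : ℝ} (hx : 0 < x) (p : ℝ) : x ^ (p - 1 / 2) = x ^ p / Real.sqrt x := by
  rw [Real.rpow_sub hx, Real.sqrt_eq_rpow]

/-- **Power-scale form of the recessive asymptotics.** From `|x^ℓ u − 1| ≤ 4A/√x`,
`|x^{ℓ+1}u' + ℓ| ≤ (4ℓ+1)A/√x` (`x ≥ 1`): `|u − x^{-ℓ}| ≤ 4A x^{-ℓ-1/2}`,
`|u' + ℓ x^{-ℓ-1}| ≤ (4ℓ+1)A x^{-ℓ-3/2}`, `|u⁻¹ − x^ℓ| ≤ 6A x^{ℓ-1/2}`, `|u⁻² − x^{2ℓ}| ≤ 21A x^{2ℓ-1/2}`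
(the last two need `4A/√x ≤ 1/3`). [folklore] -/
theorem recessive_powerScale (ℓ : ℕ) {u u' : ℝ → ℝ} {x : ℝ} (hx : 1 ≤ x) (hA : 0 ≤ A)
    (h4 : 4 * A / Real.sqrt x ≤ 1 / 3)
    (hu : |x ^ ℓ * u x - 1| ≤ 4 * A / Real.sqrt x)
    (hu' : |x ^ (ℓ + 1) * u' x + ℓ| ≤ (4 * ℓ + 1) * A / Real.sqrt x) :
    |u x - x ^ (-(ℓ : ℝ))| ≤ 4 * A * x ^ (-(ℓ : ℝ) - 1 / 2)
    ∧ |u' x - (-(ℓ : ℝ)) * x ^ (-(ℓ : ℝ) - 1)| ≤ (4 * ℓ + 1) * A * x ^ (-(ℓ : ℝ) - 1 - 1 / 2)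
    ∧ |(u x)⁻¹ - x ^ (ℓ : ℝ)| ≤ 6 * A * x ^ ((ℓ : ℝ) - 1 / 2)
    ∧ |(u x)⁻¹ ^ 2 - x ^ (2 * (ℓ : ℝ))| ≤ 21 * A * x ^ (2 * (ℓ : ℝ) - 1 / 2) := by
  have hx0 : 0 < x := lt_of_lt_of_le one_pos hx
  have hs : 0 < Real.sqrt x := Real.sqrt_pos.2 hx0
  have hxl : 0 < x ^ ℓ := pow_pos hx0 ℓ
  set ε : ℝ := 4 * A / Real.sqrt x with hε
  have hε0 : 0 ≤ ε := by positivity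
  -- conversions of the powers
  have e1 : x ^ (-(ℓ : ℝ)) = (x ^ ℓ)⁻¹ := rpow_neg_natCast_inv hx0.le ℓ
  have e2 : x ^ (-(ℓ : ℝ) - 1 / 2) = (x ^ ℓ)⁻¹ / Real.sqrt x := by
    rw [rpow_sub_half_eq hx0, e1]
  have e3 : x ^ (-(ℓ : ℝ) - 1) = (x ^ (ℓ + 1))⁻¹ := by
    rw [show (-(ℓ : ℝ) - 1) = -((ℓ + 1 : ℕ) : ℝ) by push_cast; ring]
    exact rpow_neg_natCast_inv hx0.le (ℓ + 1)
  have e4 : x ^ (-(ℓ : ℝ) - 1 - 1 / 2) = (x ^ (ℓ + 1))⁻¹ / Real.sqrt x := by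
    rw [rpow_sub_half_eq hx0, e3]
  have e5 : x ^ (ℓ : ℝ) = x ^ ℓ := Real.rpow_natCast x ℓ
  have e6 : x ^ ((ℓ : ℝ) - 1 / 2) = x ^ ℓ / Real.sqrt x := by rw [rpow_sub_half_eq hx0, e5]
  have e7 : x ^ (2 * (ℓ : ℝ)) = (x ^ ℓ) ^ 2 := by
    rw [show (2 * (ℓ : ℝ)) = ((2 * ℓ : ℕ) : ℝ) by push_cast; ring, Real.rpow_natCast, pow_mul']
  have e8 : x ^ (2 * (ℓ : ℝ) - 1 / 2) = (x ^ ℓ) ^ 2 / Real.sqrt x := by rw [rpow_sub_half_eq hx0, e7]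
  -- the normalised value `z = x^ℓ u ∈ [2/3, 4/3]`
  set z : ℝ := x ^ ℓ * u x with hz
  have hz1 : |z - 1| ≤ ε := hu
  have hz23 : 2 / 3 ≤ z := by linarith [(abs_le.1 (hz1.trans h4)).1]
  have hz43 : z ≤ 4 / 3 := by linarith [(abs_le.1 (hz1.trans h4)).2]
  have hz0 : 0 < z := by linarith
  have hux : u x = z / x ^ ℓ := by rw [hz]; field_simp
  refine ⟨?_, ?_, ?_, ?_⟩
  · rw [e1, e2, hux]
    have : z / x ^ ℓ - (x ^ ℓ)⁻¹ = (z - 1) / x ^ ℓ := by field_simp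
    rw [this, abs_div, abs_of_pos hxl, div_le_iff₀ hxl]
    calc |z - 1| ≤ ε := hz1
      _ = 4 * A * ((x ^ ℓ)⁻¹ / Real.sqrt x) * x ^ ℓ := by rw [hε]; field_simp
  · rw [e3, e4]
    have hxl1 : 0 < x ^ (ℓ + 1) := pow_pos hx0 _
    have : u' x - -(ℓ : ℝ) * (x ^ (ℓ + 1))⁻¹ = (x ^ (ℓ + 1) * u' x + ℓ) / x ^ (ℓ + 1) := by
      field_simp
      ring
    rw [this, abs_div, abs_of_pos hxl1, div_le_iff₀ hxl1]
    calc |x ^ (ℓ + 1) * u' x + ℓ| ≤ (4 * ℓ + 1) * A / Real.sqrt x := hu'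
      _ = (4 * ℓ + 1) * A * ((x ^ (ℓ + 1))⁻¹ / Real.sqrt x) * x ^ (ℓ + 1) := by field_simp
  · rw [e5, e6, hux]
    have : (z / x ^ ℓ)⁻¹ - x ^ ℓ = x ^ ℓ * ((1 - z) / z) := by field_simp
    rw [this, abs_mul, abs_of_pos hxl, abs_div, abs_of_pos hz0]
    have hkey : |1 - z| / z ≤ 3 / 2 * ε := by
      rw [div_le_iff₀ hz0, abs_sub_comm]
      nlinarith [hz1, abs_nonneg (z - 1)]
    calc x ^ ℓ * (|1 - z| / z) ≤ x ^ ℓ * (3 / 2 * ε) := mul_le_mul_of_nonneg_left hkey hxl.le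
      _ = 6 * A * (x ^ ℓ / Real.sqrt x) := by rw [hε]; ring
  · rw [e7, e8, hux]
    have : (z / x ^ ℓ)⁻¹ ^ 2 - (x ^ ℓ) ^ 2 = (x ^ ℓ) ^ 2 * ((1 - z) * (1 + z) / z ^ 2) := by
      field_simp
      ring
    rw [this, abs_mul, abs_of_pos (pow_pos hxl 2), abs_div, abs_of_pos (pow_pos hz0 2), abs_mul,
      abs_of_pos (by linarith : (0 : ℝ) < 1 + z)]
    have hkey : |1 - z| * (1 + z) / z ^ 2 ≤ 21 / 4 * ε := by
      rw [div_le_iff₀ (pow_pos hz0 2), abs_sub_comm]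
      have h1 : |z - 1| * (1 + z) ≤ ε * (7 / 3) := mul_le_mul hz1 (by linarith) (by linarith) hε0
      have hz2 : 4 / 9 ≤ z ^ 2 := by nlinarith
      have h2 : ε * (7 / 3) ≤ 21 / 4 * ε * z ^ 2 := by
        nlinarith [mul_le_mul_of_nonneg_left hz2 hε0]
      linarith
    calc (x ^ ℓ) ^ 2 * (|1 - z| * (1 + z) / z ^ 2) ≤ (x ^ ℓ) ^ 2 * (21 / 4 * ε) :=
          mul_le_mul_of_nonneg_left hkey (pow_pos hxl 2).le
      _ = 21 * A * ((x ^ ℓ) ^ 2 / Real.sqrt x) := by rw [hε]; ring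

/-- **A fundamental system with Euler asymptotics.** For `ℓ : ℕ`, `X ≥ 1`, `W` continuous on
`[X, ∞)` with `|W| ≤ A/(x²√x)` and `12A ≤ √X`, there are solutions `u, u₂` of
`y'' = (ℓ(ℓ+1)/x² + W) y` on `(X, ∞)` (with derivatives `u', u₂'`, all four continuous on `[X, ∞)`),
Wronskian `u u₂' − u' u₂ = 1`, `u > 0`, and, for one constant `K` and all `x ≥ X`:
`|u − x^{-ℓ}| ≤ K x^{-ℓ-1/2}`, `|u' + ℓx^{-ℓ-1}| ≤ K x^{-ℓ-3/2}`, `|u₂ − x^{ℓ+1}/(2ℓ+1)| ≤ K x^{ℓ+1/2}`,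
`|u₂' − (ℓ+1)x^ℓ/(2ℓ+1)| ≤ K x^{ℓ-1/2}` (real powers). Reduction of order `u₂ = u∫_X^x u^{-2}` and the
power-scale calculus. (Hartman, ODE, Ch. XI §9). [folklore] -/
theorem exists_fundamental_inverseSquareTail (ℓ : ℕ) (hX : 1 ≤ X) (hW : ContinuousOn W (Ici X))
    (hWA : ∀ y, X ≤ y → |W y| ≤ A / (y ^ 2 * Real.sqrt y)) (hAX : 12 * A ≤ Real.sqrt X) :
    ∃ u u' u₂ u₂' : ℝ → ℝ, ∃ K : ℝ,
      ContinuousOn u (Ici X) ∧ ContinuousOn u' (Ici X) ∧ ContinuousOn u₂ (Ici X)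
      ∧ ContinuousOn u₂' (Ici X)
      ∧ (∀ x, X < x → HasDerivAt u (u' x) x)
      ∧ (∀ x, X < x → HasDerivAt u' (((ℓ : ℝ) * (ℓ + 1) / x ^ 2 + W x) * u x) x)
      ∧ (∀ x, X < x → HasDerivAt u₂ (u₂' x) x)
      ∧ (∀ x, X < x → HasDerivAt u₂' (((ℓ : ℝ) * (ℓ + 1) / x ^ 2 + W x) * u₂ x) x)
      ∧ (∀ x, X ≤ x → u x * u₂' x - u' x * u₂ x = 1)
      ∧ (∀ x, X ≤ x → 0 < u x)
      ∧ (∀ x, X ≤ x → |u x - x ^ (-(ℓ : ℝ))| ≤ K * x ^ (-(ℓ : ℝ) - 1 / 2))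
      ∧ (∀ x, X ≤ x → |u' x - (-(ℓ : ℝ)) * x ^ (-(ℓ : ℝ) - 1)| ≤ K * x ^ (-(ℓ : ℝ) - 1 - 1 / 2))
      ∧ (∀ x, X ≤ x → |u₂ x - (2 * (ℓ : ℝ) + 1)⁻¹ * x ^ ((ℓ : ℝ) + 1)| ≤ K * x ^ ((ℓ : ℝ) + 1 - 1 / 2))
      ∧ (∀ x, X ≤ x → |u₂' x - ((ℓ : ℝ) + 1) / (2 * ℓ + 1) * x ^ (ℓ : ℝ)|
          ≤ K * x ^ ((ℓ : ℝ) - 1 / 2)) := by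
  have hX0 : 0 < X := lt_of_lt_of_le one_pos hX
  have hA : 0 ≤ A := nonneg_of_abs_le_div_sqrt hX0 (hWA X le_rfl)
  obtain ⟨u, u', huc, hu'c, hud, hu'd, hu1, hu'1, hupos⟩ :=
    exists_inverseSquareTail_recessive ℓ hX hW hWA hAX
  -- smallness `4A/√x ≤ 1/3` on `[X, ∞)`
  have h4 : ∀ x, X ≤ x → 4 * A / Real.sqrt x ≤ 1 / 3 := by
    intro x hx
    have hs : 0 < Real.sqrt x := Real.sqrt_pos.2 (hX0.trans_le hx)
    have hsX : Real.sqrt X ≤ Real.sqrt x := Real.sqrt_le_sqrt hx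
    rw [div_le_div_iff₀ hs (by norm_num)]; nlinarith
  have hps : ∀ x, X ≤ x → _ := fun x hx =>
    recessive_powerScale ℓ (hX.trans hx) hA (h4 x hx) (hu1 x hx) (hu'1 x hx)
  -- the clamped integrand `u^{-2}` and its primitive
  have hune : ∀ x, X ≤ x → u x ≠ 0 := fun x hx => (hupos x hx).ne'
  set f : ℝ → ℝ := fun y => (u (max y X))⁻¹ ^ 2 with hf
  have hfc : Continuous f := by
    have h1 : Continuous fun y => u (max y X) := continuous_comp_max_of_continuousOn huc
    exact (h1.inv₀ fun y => hune _ (le_max_right _ _)).pow 2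
  have hf_eq : ∀ y, X ≤ y → f y = (u y)⁻¹ ^ 2 := fun y hy => by
    simp only [hf, max_eq_left hy]
  set I : ℝ → ℝ := fun x => ∫ y in X..x, f y with hI
  have hIc : Continuous I := intervalIntegral.continuous_primitive (fun a b => hfc.intervalIntegrable a b) X
  have hId : ∀ x, X < x → HasDerivAt I ((u x)⁻¹ ^ 2) x := by
    intro x hx
    have h := intervalIntegral.integral_hasDerivAt_right (hfc.intervalIntegrable X x)
      (hfc.stronglyMeasurableAtFilter _ _) hfc.continuousAt
    rw [hf_eq x hx.le] at h
    exact h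
  -- asymptotics of `I`
  have hf_as : ∀ y, X ≤ y → |f y - 1 * y ^ (2 * (ℓ : ℝ))| ≤ 21 * A * y ^ (2 * (ℓ : ℝ) - 1 / 2) := by
    intro y hy
    rw [hf_eq y hy, one_mul]
    exact (hps y hy).2.2.2
  set D : ℝ := Real.sqrt X / (2 * ℓ + 1) + 21 * A / (2 * ℓ + 1 / 2) with hD
  have hD0 : 0 ≤ D := by positivity
  have hI_as : ∀ x, X ≤ x → |I x - (2 * (ℓ : ℝ) + 1)⁻¹ * x ^ (2 * (ℓ : ℝ) + 1)|
      ≤ D * x ^ (2 * (ℓ : ℝ) + 1 - 1 / 2) := by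
    intro x hx
    have h := asymp_integral_interval (a := 1) hX hfc.continuousOn (by positivity) hf_as hx
    simp only [abs_one, one_mul, one_div] at h
    rw [hD]
    convert h using 2 <;> ring_nf
  -- power-scale forms of the recessive asymptotics
  have hu_as : ∀ x, X ≤ x → |u x - 1 * x ^ (-(ℓ : ℝ))| ≤ 4 * A * x ^ (-(ℓ : ℝ) - 1 / 2) := by
    intro x hx; rw [one_mul]; exact (hps x hx).1
  have hu'_as : ∀ x, X ≤ x → |u' x - (-(ℓ : ℝ)) * x ^ (-(ℓ : ℝ) - 1)|
      ≤ (4 * ℓ + 1) * A * x ^ (-(ℓ : ℝ) - 1 - 1 / 2) := fun x hx => (hps x hx).2.1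
  have hinv_as : ∀ x, X ≤ x → |(u x)⁻¹ - x ^ (ℓ : ℝ)| ≤ 6 * A * x ^ ((ℓ : ℝ) - 1 / 2) :=
    fun x hx => (hps x hx).2.2.1
  -- the dominant solution and its derivative
  set u₂ : ℝ → ℝ := fun x => u x * I x with hu₂
  set u₂' : ℝ → ℝ := fun x => u' x * I x + (u x)⁻¹ with hu₂'
  -- asymptotics of `u₂ = u I` and `u₂' = u' I + u⁻¹`
  set K₃ : ℝ := 4 * A * (|(2 * (ℓ : ℝ) + 1)⁻¹| + D) + |(1 : ℝ)| * D with hK₃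
  set K₄ : ℝ := (4 * ℓ + 1) * A * (|(2 * (ℓ : ℝ) + 1)⁻¹| + D) + |(-(ℓ : ℝ))| * D + 6 * A with hK₄
  have hK₃0 : 0 ≤ K₃ := by positivity
  have hK₄0 : 0 ≤ K₄ := by positivity
  have hu₂_as : ∀ x, X ≤ x → |u₂ x - (2 * (ℓ : ℝ) + 1)⁻¹ * x ^ ((ℓ : ℝ) + 1)|
      ≤ K₃ * x ^ ((ℓ : ℝ) + 1 - 1 / 2) := by
    intro x hx
    have h := asymp_mul hX hu_as hI_as hx
    rw [one_mul, show (-(ℓ : ℝ) + (2 * (ℓ : ℝ) + 1)) = (ℓ : ℝ) + 1 by ring] at h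
    exact h
  have hu₂'_as : ∀ x, X ≤ x → |u₂' x - ((ℓ : ℝ) + 1) / (2 * ℓ + 1) * x ^ (ℓ : ℝ)|
      ≤ K₄ * x ^ ((ℓ : ℝ) - 1 / 2) := by
    intro x hx
    have hx0 : 0 < x := hX0.trans_le hx
    have h := asymp_mul hX hu'_as hI_as hx
    rw [show (-(ℓ : ℝ) - 1 + (2 * (ℓ : ℝ) + 1)) = (ℓ : ℝ) by ring] at h
    have h2 := hinv_as x hx
    have e : u₂' x - ((ℓ : ℝ) + 1) / (2 * ℓ + 1) * x ^ (ℓ : ℝ)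
        = (u' x * I x - -(ℓ : ℝ) * (2 * (ℓ : ℝ) + 1)⁻¹ * x ^ (ℓ : ℝ)) + ((u x)⁻¹ - x ^ (ℓ : ℝ)) := by
      simp only [hu₂']
      have hn : (2 * (ℓ : ℝ) + 1) ≠ 0 := by positivity
      field_simp
      ring
    rw [e]
    calc |(u' x * I x - -(ℓ : ℝ) * (2 * (ℓ : ℝ) + 1)⁻¹ * x ^ (ℓ : ℝ)) + ((u x)⁻¹ - x ^ (ℓ : ℝ))|
        ≤ |u' x * I x - -(ℓ : ℝ) * (2 * (ℓ : ℝ) + 1)⁻¹ * x ^ (ℓ : ℝ)| + |(u x)⁻¹ - x ^ (ℓ : ℝ)| :=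
          abs_add_le _ _
      _ ≤ ((4 * ℓ + 1) * A * (|(2 * (ℓ : ℝ) + 1)⁻¹| + D) + |(-(ℓ : ℝ))| * D) * x ^ ((ℓ : ℝ) - 1 / 2)
          + 6 * A * x ^ ((ℓ : ℝ) - 1 / 2) := add_le_add h h2
      _ = K₄ * x ^ ((ℓ : ℝ) - 1 / 2) := by rw [hK₄]; ring
  -- one common constant
  set K : ℝ := 4 * A + (4 * ℓ + 1) * A + K₃ + K₄ with hK
  have hK1 : 4 * A ≤ K := by rw [hK]; nlinarith
  have hK2 : (4 * ℓ + 1) * A ≤ K := by rw [hK]; nlinarith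
  have hK3 : K₃ ≤ K := by rw [hK]; nlinarith
  have hK4 : K₄ ≤ K := by rw [hK]; nlinarith
  have weaken : ∀ {r K' e x : ℝ}, 0 < x → |r| ≤ K' * x ^ e → K' ≤ K → |r| ≤ K * x ^ e :=
    fun {r K' e x} hx h hK' => h.trans (mul_le_mul_of_nonneg_right hK' (Real.rpow_pos_of_pos hx e).le)
  refine ⟨u, u', u₂, u₂', K, huc, hu'c, ?_, ?_, hud, hu'd, fun x hx => ?_, fun x hx => ?_,
    fun x hx => ?_, hupos, fun x hx => ?_, fun x hx => ?_, fun x hx => ?_, fun x hx => ?_⟩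
  · exact huc.mul hIc.continuousOn
  · exact (hu'c.mul hIc.continuousOn).add (huc.inv₀ fun x hx => hune x hx)
  · -- `u₂' = du₂/dx`
    have h := (hud x hx).mul (hId x hx)
    refine h.congr_deriv ?_
    simp only [hu₂']
    have := hune x hx.le
    field_simp
  · -- `du₂'/dx = (ℓ(ℓ+1)/x² + W) u₂`
    have hux := hune x hx.le
    have h := ((hu'd x hx).mul (hId x hx)).add ((hud x hx).inv hux)
    refine h.congr_deriv ?_
    simp only [hu₂]
    field_simp
    ring
  · -- Wronskian
    simp only [hu₂, hu₂']
    have := hune x hx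
    field_simp
    ring
  · exact weaken (hX0.trans_le hx) (by simpa using hu_as x hx) hK1
  · exact weaken (hX0.trans_le hx) (hu'_as x hx) hK2
  · exact weaken (hX0.trans_le hx) (hu₂_as x hx) hK3
  · exact weaken (hX0.trans_le hx) (hu₂'_as x hx) hK4

end Literature.Analysis.ODE
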